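import Literature.RepresentationTheory.TwistedCoinvariants
import Mathlib.Topology.Algebra.Group.Basic
import HarnessLib

/-!
# Twisted coinvariants and intertwiners under a discontinuous twist vanish

Topic `RepresentationTheory`; namespace `Literature.RepresentationTheory.TwistedCoinv`.  Kernel consequences (Mathlib +
`TwistedCoinvariants.lean` only) of SMOOTHNESS — «every vector is fixed by an open subgroup» (Bernstein–Zelevinsky
1976, §2.1; the shape of the tree's `weilCoinv_comp_smooth`, `finPairRepW_smooth`) — against a scalar twist that is
NOT trivial on any open subgroup («discontinuous»: for a character with values in a field carrying no topology, being
trivial on some open subgroup is the only continuity there is):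

* `TwistedCoinv.mk_eq_zero_of_forall_exists_ne_one`, `….subsingleton_of_forall_exists_ne_one` — if every vector of
  `S` is fixed by an open subgroup of `H` under `ρW` and the character `χ` is non-trivial on every open subgroup, the
  `χ`-coinvariants `Coinv ρW χ` are ZERO: for `v` fixed by an open `K` and `u ∈ K` with `χ u ≠ 1`,
  `[v] = [ρW u v] = χ u • [v]`;
* `TwistedCoinv.exists_isOpen_forall_eq_one_of_nontrivial` — contrapositive: NON-ZERO `χ`-coinvariants of such a
  (smooth) `ρW` force `χ` to be trivial on some open subgroup;
* `TwistedCoinv.linearMap_eq_zero_of_forall_exists_ne_one` — a linear map `ψ : M → M'` between two modules on which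
  `G` acts with every vector fixed by an open subgroup, intertwining up to a scalar `ψ (π g m) = c g • π' g (ψ m)`
  with `c` non-trivial on every open subgroup, is ZERO (`ψ m = ψ (π g m) = c g • ψ m` for `g` in the open subgroup
  fixing both `m` and `ψ m`); `….linearMap_eq_zero_of_twist` — the same for `ψ` intertwining the twist `g ↦ c g • π g`
  with `π'`.

These are the two «three-line arguments» by which a central twist of a dual-pair splitting by a DISCONTINUOUS
character contributes nothing: the twisted Weil coinvariants vanish, and no non-zero equivariant map reaches a smooth
module such as `colim_K H¹(X_K(ℂ); ℂ)` (Gelbart–Rogawski 1991, §3.1 Remark p. 457: compatible splittings differ by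
characters of the centre; only continuous data enter [Liu2021, Def. 4.11]).  Theorems only; no definition, no named
fact, no instance, no `sorry`.

## References
* I. N. Bernstein, A. V. Zelevinsky, *Representations of the group GL(n, F) where F is a non-archimedean local
  field*, Russian Math. Surveys 31:3 (1976), §2.1 (smooth representations: open stabilisers). [BernsteinZelevinsky1976]
* S. Gelbart, J. Rogawski, *L-functions and Fourier–Jacobi coefficients for the unitary group U(3)*, Invent. Math.
  105 (1991), §3.1 Remark p. 457. [GelbartRogawski1991]
-/

noncomputable section

namespace Literature.RepresentationTheory.TwistedCoinv

/-! ### §1 Coinvariants by a character that is non-trivial on every open subgroup -/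

section Coinv

variable {k : Type*} [Field k] {H S : Type*} [Group H] [TopologicalSpace H] [AddCommGroup S] [Module k S]

omit [TopologicalSpace H] in
/-- **Twisted coinvariants by a discontinuous character vanish, class by class.**  If `v` is fixed under `ρW` by an
open subgroup `K` of `H` and `χ` takes a value `≠ 1` on `K`, then `[v] = 0` in `Coinv ρW χ`:
`[v] = [ρW u v] = χ u • [v]` with `χ u ≠ 1`.  (Smooth vectors: Bernstein–Zelevinsky 1976, §2.1.)
[cite: BernsteinZelevinsky1976, §2.1] -/
theorem mk_eq_zero_of_exists_ne_one (ρW : Representation k H S) (χ : H →* kˣ) {v : S} {K : Subgroup H}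
    (hfix : ∀ u ∈ K, ρW u v = v) (hχ : ∃ u ∈ K, χ u ≠ 1) : mk ρW χ v = 0 := by
  obtain ⟨u, hu, hne⟩ := hχ
  have h1 : mk ρW χ v = ((χ u : kˣ) : k) • mk ρW χ v := by
    conv_lhs => rw [← hfix u hu]
    exact mk_ρW ρW χ u v
  have h2 : (1 - ((χ u : kˣ) : k)) • mk ρW χ v = 0 := by
    rw [sub_smul, one_smul, ← h1, sub_self]
  rcases smul_eq_zero.1 h2 with h | h
  · exact absurd (Units.ext (sub_eq_zero.1 h).symm) hne
  · exact h

/-- **Twisted coinvariants of a smooth representation by a discontinuous character vanish.**  If every vector of `S`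
is fixed under `ρW` by some open subgroup of `H` («smooth») and `χ` is non-trivial on EVERY open subgroup, then every
class `[v] ∈ Coinv ρW χ` is `0`. [cite: BernsteinZelevinsky1976, §2.1] -/
theorem mk_eq_zero_of_forall_exists_ne_one (ρW : Representation k H S) (χ : H →* kˣ)
    (hsm : ∀ v : S, ∃ K : Subgroup H, IsOpen (K : Set H) ∧ ∀ u ∈ K, ρW u v = v)
    (hχ : ∀ K : Subgroup H, IsOpen (K : Set H) → ∃ u ∈ K, χ u ≠ 1) (v : S) : mk ρW χ v = 0 := by
  obtain ⟨K, hK, hfix⟩ := hsm v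
  exact mk_eq_zero_of_exists_ne_one ρW χ hfix (hχ K hK)

/-- The same, packaged: `Coinv ρW χ` is a trivial module. [cite: BernsteinZelevinsky1976, §2.1] -/
theorem subsingleton_of_forall_exists_ne_one (ρW : Representation k H S) (χ : H →* kˣ)
    (hsm : ∀ v : S, ∃ K : Subgroup H, IsOpen (K : Set H) ∧ ∀ u ∈ K, ρW u v = v)
    (hχ : ∀ K : Subgroup H, IsOpen (K : Set H) → ∃ u ∈ K, χ u ≠ 1) : Subsingleton (Coinv ρW χ) := by
  refine subsingleton_of_forall_eq 0 fun x => ?_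
  obtain ⟨v, rfl⟩ := mk_surjective ρW χ x
  exact mk_eq_zero_of_forall_exists_ne_one ρW χ hsm hχ v

/-- **Contrapositive: non-zero coinvariants force continuity of the character.**  If every vector is fixed by an
open subgroup and `Coinv ρW χ` is non-trivial, then `χ` is trivial on some open subgroup of `H`.
[cite: BernsteinZelevinsky1976, §2.1] -/
theorem exists_isOpen_forall_eq_one_of_nontrivial (ρW : Representation k H S) (χ : H →* kˣ)
    (hsm : ∀ v : S, ∃ K : Subgroup H, IsOpen (K : Set H) ∧ ∀ u ∈ K, ρW u v = v)
    [hnt : Nontrivial (Coinv ρW χ)] : ∃ K : Subgroup H, IsOpen (K : Set H) ∧ ∀ u ∈ K, χ u = 1 := by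
  by_contra hcon
  push Not at hcon
  exact not_subsingleton (Coinv ρW χ) (subsingleton_of_forall_exists_ne_one ρW χ hsm hcon)

end Coinv

/-! ### §2 Intertwiners twisted by a discontinuous scalar -/

section Intertwiner

variable {k : Type*} [Field k] {G M M' : Type*} [Group G] [TopologicalSpace G]
  [AddCommGroup M] [Module k M] [AddCommGroup M'] [Module k M']

/-- **A twisted intertwiner between smooth modules vanishes.**  Let `G` act on `M` and `M'` through `π`, `π'`
with every vector fixed by an open subgroup, and let `ψ : M → M'` be linear with `ψ (π g m) = c g • π' g (ψ m)` for a
scalar function `c` taking a value `≠ 1` on every open subgroup.  Then `ψ = 0`: for `g` in the open subgroup fixing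
both `m` and `ψ m`, `ψ m = c g • ψ m`. [cite: BernsteinZelevinsky1976, §2.1] -/
theorem linearMap_eq_zero_of_forall_exists_ne_one (π : Representation k G M) (π' : Representation k G M')
    (hπ : ∀ m : M, ∃ K : Subgroup G, IsOpen (K : Set G) ∧ ∀ g ∈ K, π g m = m)
    (hπ' : ∀ m' : M', ∃ K : Subgroup G, IsOpen (K : Set G) ∧ ∀ g ∈ K, π' g m' = m')
    (c : G → k) (hc : ∀ K : Subgroup G, IsOpen (K : Set G) → ∃ g ∈ K, c g ≠ 1)
    (ψ : M →ₗ[k] M') (hψ : ∀ (g : G) (m : M), ψ (π g m) = c g • π' g (ψ m)) : ψ = 0 := by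
  refine LinearMap.ext fun m => ?_
  obtain ⟨K₁, hK₁, h₁⟩ := hπ m
  obtain ⟨K₂, hK₂, h₂⟩ := hπ' (ψ m)
  obtain ⟨g, hg, hne⟩ := hc (K₁ ⊓ K₂) (by
    rw [Subgroup.coe_inf]
    exact hK₁.inter hK₂)
  have h3 : ψ m = c g • ψ m := by
    conv_lhs => rw [← h₁ g (Subgroup.mem_inf.1 hg).1, hψ, h₂ g (Subgroup.mem_inf.1 hg).2]
  have h4 : (1 - c g) • ψ m = 0 := by rw [sub_smul, one_smul, ← h3, sub_self]
  rcases smul_eq_zero.1 h4 with h | h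
  · exact absurd (sub_eq_zero.1 h).symm hne
  · rw [h, LinearMap.zero_apply]

/-- **The same for a twist on the source**: a linear `ψ` intertwining the twisted action `g ↦ c g • π g` on `M` with
`π'` on `M'` (`ψ (c g • π g m) = π' g (ψ m)`), with `π`, `π'` as above and `c : G → kˣ` non-trivial on every open
subgroup, is zero.  (The case of an equivariant map out of the Weil coinvariants of a splitting twisted by a
discontinuous central character into a smooth module.) [cite: BernsteinZelevinsky1976, §2.1] -/
theorem linearMap_eq_zero_of_twist (π : Representation k G M) (π' : Representation k G M')
    (hπ : ∀ m : M, ∃ K : Subgroup G, IsOpen (K : Set G) ∧ ∀ g ∈ K, π g m = m)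
    (hπ' : ∀ m' : M', ∃ K : Subgroup G, IsOpen (K : Set G) ∧ ∀ g ∈ K, π' g m' = m')
    (c : G → kˣ) (hc : ∀ K : Subgroup G, IsOpen (K : Set G) → ∃ g ∈ K, c g ≠ 1)
    (ψ : M →ₗ[k] M') (hψ : ∀ (g : G) (m : M), ψ (((c g : kˣ) : k) • π g m) = π' g (ψ m)) : ψ = 0 := by
  refine linearMap_eq_zero_of_forall_exists_ne_one π π' hπ hπ' (fun g => (((c g)⁻¹ : kˣ) : k))
    (fun K hK => ?_) ψ (fun g m => ?_)
  · obtain ⟨g, hg, hne⟩ := hc K hK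
    refine ⟨g, hg, fun h => hne ?_⟩
    exact inv_eq_one.1 (Units.ext h)
  · rw [← hψ g m, map_smul, smul_smul, Units.inv_mul, one_smul]

end Intertwiner

end Literature.RepresentationTheory.TwistedCoinv

end
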